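import Summits.AnomalousDissipation.AnomalousDissipation.Theorems.SolenoidalFractalHomogenisationLagrangianStepVmodDistortedDefs
import Summits.AnomalousDissipation.AnomalousDissipation.Theorems.SolenoidalFractalHomogenisationRealisedQuasiStaticCellLawSingleMode
import Summits.AnomalousDissipation.AnomalousDissipation.Theorems.SolenoidalFractalHomogenisationRealisedQuasiStaticCellLawSectorReduction
import Literature.Analysis.FluidPDE.PassiveVectorTensorLipschitzTest
import HarnessLib

/-!
# K1L_D (stmt-AnomalousDissipation-27980), (V_θ): the ANCHOR RUNG `θV = 0` — (V) without existence ⇔ (V_θ) at `θV = 0`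
(line file of the (V_mod)/(ℓ3) lane; prover lead-k1l-onelevel-p1 g6; certifier N6 2026-08-29T09:15:09Z, tenure RULING D27-16′: «first landed rung of the line».)

* `clauseFθ_zero_of_noExF : SlowVectorClauseNoExF … → SlowVectorClauseFθ … 0` — at `θV = 0` the entrywise bound forces `G₀ = 1`, and
  `IsWeakTensorPassiveVectorDistortedOn.of_one_toFlat` turns both frozen members into flat ones;
* `noExF_of_clauseFθ : 0 ≤ θV → SlowVectorClauseFθ … θV → SlowVectorClauseNoExF …` — conversely any member of the family contains `G₀ = 1`
  (`IsWeakTensorPassiveVectorOn.toDistorted_one`, single-mode datum in `L²`): the bridge `clauseF_of_clauseFθ` of the card, NoEx form.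
* `SlowVectorClauseFθ.congr_Ioo`, `.mono_ν₀` (RULING D28-1 (2): twins of `SlowVectorClauseNoExF.congr_Ioo/.mono_ν₀` for the design glue), `.mono_θV`.
So the (V_θ) text is wired correctly at its anchor (BC5-style witness).  `sorry`-free; NOT a proof of (V) or (V_θ) for any `θV > 0`; K1L_D open; AD NOT proved; F-D1.A0.
-/

set_option linter.dupNamespace false

noncomputable section

namespace Summit.AnomalousDissipation.AnomalousDissipation.Theorems.SolenoidalFractalHomogenisation.LagrangianStep.VmodDist

open Literature.Analysis Literature.Analysis.FluidPDE Literature.Analysis.FunctionSpaces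
open MeasureTheory Set
open scoped InnerProductSpace
open Summit.AnomalousDissipation.AnomalousDissipation.Theorems.SolenoidalFractalHomogenisation.RealisedQuasiStaticCellLaw
  (memLp_two_of_memSobolev_one_complexify memSobolev_one_singleMode)

/-- An entrywise bound `|G₀ − 1| ≤ 0` forces `G₀ = 1`. [folklore] -/
theorem eq_one_of_abs_sub_le_zero {G₀ : Matrix (Fin 3) (Fin 3) ℝ} (h : ∀ i j, |G₀ i j - (1 : Matrix (Fin 3) (Fin 3) ℝ) i j| ≤ 0) : G₀ = 1 := by
  ext i j
  have hij := h i j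
  have h0 : |G₀ i j - (1 : Matrix (Fin 3) (Fin 3) ℝ) i j| = 0 := le_antisymm hij (abs_nonneg _)
  rw [abs_eq_zero, sub_eq_zero] at h0
  exact h0

/-- The datum condition at `G₀ = 1` is (V)'s `⟪p, ℓ⟫ = 0`. [folklore] -/
theorem inner_toLp_one_mulVec (p : EuclideanSpace ℝ (Fin 3)) (ℓ : Fin 3 → ℤ) :
    ⟪(WithLp.toLp 2 ((1 : Matrix (Fin 3) (Fin 3) ℝ).mulVec (WithLp.ofLp p)) : EuclideanSpace ℝ (Fin 3)), Torus.latticeVec ℓ⟫_ℝ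
      = ⟪p, Torus.latticeVec ℓ⟫_ℝ := by
  rw [Matrix.one_mulVec, WithLp.toLp_ofLp]

/-- **Anchor rung, forward: (V) without existence implies (V_θ) at `θV = 0`.** -/
theorem clauseFθ_zero_of_noExF {k : ℕ} {W : LatticeShear.LatticeWord k} {M : ℝ} {hM : 0 < M} {c : ℝ}
    {Φ : ℝ → Torus.Visc4 (Fin 3) → Torus.Visc4 (Fin 3)} {lo hi Λ β σ C ν₀ K : ℝ}
    (h : SlowVectorClauseNoExF W M hM c Φ lo hi Λ β σ C ν₀ K) : SlowVectorClauseFθ W M hM c Φ lo hi Λ β σ C ν₀ K 0 := by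
  intro G₀ _ hG ν hν n 𝔸 hodd hwin ℓ hℓ hKn p hp hperp T hT w v hw hv
  obtain rfl : G₀ = 1 := eq_one_of_abs_sub_le_zero hG
  rw [inner_toLp_one_mulVec] at hperp
  exact h ν hν n 𝔸 hodd hwin ℓ hℓ hKn p hp hperp T hT w v hw.of_one_toFlat hv.of_one_toFlat

/-- **Anchor rung, backward: (V_θ) at any `θV ≥ 0` implies (V) without existence** (the family contains `G₀ = 1`; flat solutions from `L²` single-mode
data are distorted ones with `G ≡ 1` by `IsWeakTensorPassiveVectorOn.toDistorted_one`). -/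
theorem noExF_of_clauseFθ {k : ℕ} {W : LatticeShear.LatticeWord k} {M : ℝ} {hM : 0 < M} {c : ℝ}
    {Φ : ℝ → Torus.Visc4 (Fin 3) → Torus.Visc4 (Fin 3)} {lo hi Λ β σ C ν₀ K θV : ℝ} (hθV : 0 ≤ θV)
    (h : SlowVectorClauseFθ W M hM c Φ lo hi Λ β σ C ν₀ K θV) : SlowVectorClauseNoExF W M hM c Φ lo hi Λ β σ C ν₀ K := by
  intro ν hν n 𝔸 hodd hwin ℓ hℓ hKn p hp hperp T hT w v hw hv
  have hG : ∀ i j, |(1 : Matrix (Fin 3) (Fin 3) ℝ) i j - (1 : Matrix (Fin 3) (Fin 3) ℝ) i j| ≤ θV := fun i j => by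
    rw [sub_self, abs_zero]; exact hθV
  have hperp' : ⟪(WithLp.toLp 2 ((1 : Matrix (Fin 3) (Fin 3) ℝ).mulVec (WithLp.ofLp p)) : EuclideanSpace ℝ (Fin 3)), Torus.latticeVec ℓ⟫_ℝ = 0 := by
    rw [inner_toLp_one_mulVec]; exact hperp
  have hL2 : MemLp (fun x => (UnitAddTorus.mFourier ℓ x).re • p) 2 volume :=
    memLp_two_of_memSobolev_one_complexify (memSobolev_one_singleMode ℓ p)
  exact h 1 Matrix.det_one hG ν hν n 𝔸 hodd hwin ℓ hℓ hKn p hp hperp' T hT w v (hw.toDistorted_one hL2) (hv.toDistorted_one hL2)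

/-! ## The two design-glue twins (RULING D28-1 (2)): `congr_Ioo` and `mono_ν₀` for (V_θ) -/

/-- The (V_θ) clause only evaluates the shape map on `(0, ν₀)`: maps agreeing there satisfy it simultaneously
(twin of `SlowVectorClauseNoExF.congr_Ioo`). [folklore] -/
theorem SlowVectorClauseFθ.congr_Ioo {k : ℕ} {W : LatticeShear.LatticeWord k} {M : ℝ} {hM : 0 < M} {c : ℝ}
    {Ψ Ψ' : ℝ → Torus.Visc4 (Fin 3) → Torus.Visc4 (Fin 3)} {lo hi Λ β σ C ν₀ K θV : ℝ} (heq : ∀ ν ∈ Set.Ioo 0 ν₀, Ψ ν = Ψ' ν)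
    (h : SlowVectorClauseFθ W M hM c Ψ lo hi Λ β σ C ν₀ K θV) :
    SlowVectorClauseFθ W M hM c Ψ' lo hi Λ β σ C ν₀ K θV := by
  intro G₀ hdet hG ν hν n 𝔸 hodd hwin ℓ hℓ hres p hp hpl T hT w v hw hv
  rw [← heq ν hν] at hv
  exact h G₀ hdet hG ν hν n 𝔸 hodd hwin ℓ hℓ hres p hp hpl T hT w v hw hv

/-- The (V_θ) clause is monotone in the threshold: a smaller `ν₀'` is implied (twin of `SlowVectorClauseNoExF.mono_ν₀`). [folklore] -/
theorem SlowVectorClauseFθ.mono_ν₀ {k : ℕ} {W : LatticeShear.LatticeWord k} {M : ℝ} {hM : 0 < M} {c : ℝ}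
    {Ψ : ℝ → Torus.Visc4 (Fin 3) → Torus.Visc4 (Fin 3)} {lo hi Λ β σ C ν₀ ν₀' K θV : ℝ} (hle : ν₀' ≤ ν₀)
    (h : SlowVectorClauseFθ W M hM c Ψ lo hi Λ β σ C ν₀ K θV) :
    SlowVectorClauseFθ W M hM c Ψ lo hi Λ β σ C ν₀' K θV := by
  intro G₀ hdet hG ν hν n 𝔸 hodd hwin ℓ hℓ hres p hp hpl T hT w v hw hv
  have hν' : ν ∈ Set.Ioo 0 ν₀ := ⟨hν.1, hν.2.trans_le hle⟩
  exact h G₀ hdet hG ν hν' n 𝔸 hodd hwin ℓ hℓ hres p hp hpl T hT w v hw hv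

/-- The (V_θ) clause is antitone in `θV`: a smaller family is implied. [folklore] -/
theorem SlowVectorClauseFθ.mono_θV {k : ℕ} {W : LatticeShear.LatticeWord k} {M : ℝ} {hM : 0 < M} {c : ℝ}
    {Ψ : ℝ → Torus.Visc4 (Fin 3) → Torus.Visc4 (Fin 3)} {lo hi Λ β σ C ν₀ K θV θV' : ℝ} (hle : θV' ≤ θV)
    (h : SlowVectorClauseFθ W M hM c Ψ lo hi Λ β σ C ν₀ K θV) :
    SlowVectorClauseFθ W M hM c Ψ lo hi Λ β σ C ν₀ K θV' :=
  fun G₀ hdet hG => h G₀ hdet fun i j => (hG i j).trans hle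

end Summit.AnomalousDissipation.AnomalousDissipation.Theorems.SolenoidalFractalHomogenisation.LagrangianStep.VmodDist

end
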